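import Summits.KontsevichZagierPeriods.KontsevichZagierPeriods.Theorems.HurwitzMicroSectorsNormalFormPrincipleAngCarriers
import Summits.KontsevichZagierPeriods.KontsevichZagierPeriods.Theorems.HurwitzMicroSectorsNormalFormPrincipleAngBaker

/-!
# `NormalFormPrinciple` (stmt-KontsevichZagierPeriods-3869), line `SketchIdeator1` —
# the leaf `stub_boxRigidity` in dimension one — the signed arctangent element and its linearity

Pure proof file (lead seat c3; `--supports` the crux). The carriers `T(t, d) = [(0,t), d/(1+y²)]`
only see angles in `[0, π/2)`; the **signed arctangent element** `E(θ, d)` of the quotient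
(`E = [T(tan θ, d)]` for `θ ≥ 0`, `−[T(tan(−θ), d)]` for `θ < 0`; a family, `exists_signedAng`) is
additive as long as all angles stay in `(−π/2, π/2)` (`signedAng_add`, from the tangent addition law by
moves `…AngAddK2.ang_add_mem_relations`), hence `ℤ`-linear on bounded integer combinations
(`signedAng_nsmul`, `signedAng_zsmul`, registered sub-goal `signedAng_sum`). Closure properties of
`θ ↦ (e^{iθ} algebraic)`.

Sources: M. Kontsevich, D. Zagier, *Periods* (2001), §1.2 rules (1), (2). No definitions are introduced.
-/

noncomputable section

open MeasureTheory Set Finset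
open scoped Polynomial
open Literature.NumberTheory.Transcendental Literature.NumberTheory.Transcendental.KZ
open Literature.ModelTheory.ExponentialFields (IsSemialgebraic isSemialgebraic_univ)
open Complex

namespace Summit.KontsevichZagierPeriods.HurwitzMicroSectors.NormalFormPrinciple.PiBox

namespace Dlog

/-! ## Algebraicity closure properties of `θ ↦ e^{iθ}` -/

/-- `e^{-iθ}` is algebraic if `e^{iθ}` is. [folklore] -/
theorem isAlgebraic_exp_neg_mul_I {θ : ℝ} (h : IsAlgebraic ℚ (cexp ((θ:ℂ) * I))) :
    IsAlgebraic ℚ (cexp (((-θ : ℝ) : ℂ) * I)) := by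
  rw [Complex.ofReal_neg, neg_mul, Complex.exp_neg]
  exact h.inv

/-- `e^{i(θ₁+θ₂)}` is algebraic if `e^{iθ₁}`, `e^{iθ₂}` are. [folklore] -/
theorem isAlgebraic_exp_add_mul_I {θ₁ θ₂ : ℝ} (h₁ : IsAlgebraic ℚ (cexp ((θ₁:ℂ) * I)))
    (h₂ : IsAlgebraic ℚ (cexp ((θ₂:ℂ) * I))) :
    IsAlgebraic ℚ (cexp (((θ₁ + θ₂ : ℝ) : ℂ) * I)) := by
  rw [Complex.ofReal_add, add_mul, Complex.exp_add]
  exact h₁.mul h₂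

/-- `e^{inθ}` (`n ∈ ℕ`) is algebraic if `e^{iθ}` is. [folklore] -/
theorem isAlgebraic_exp_nat_mul_mul_I {θ : ℝ} (h : IsAlgebraic ℚ (cexp ((θ:ℂ) * I))) (n : ℕ) :
    IsAlgebraic ℚ (cexp (((n * θ : ℝ) : ℂ) * I)) := by
  rw [show (((n * θ : ℝ) : ℂ)) * I = n * ((θ:ℂ) * I) by push_cast; ring, Complex.exp_nat_mul]
  exact h.pow n

/-- `e^{inθ}` (`n ∈ ℤ`) is algebraic if `e^{iθ}` is. [folklore] -/
theorem isAlgebraic_exp_int_mul_mul_I {θ : ℝ} (h : IsAlgebraic ℚ (cexp ((θ:ℂ) * I))) (n : ℤ) :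
    IsAlgebraic ℚ (cexp (((n * θ : ℝ) : ℂ) * I)) := by
  rw [show (((n * θ : ℝ) : ℂ)) * I = n * ((θ:ℂ) * I) by push_cast; ring, Complex.exp_int_mul]
  cases n with
  | ofNat k => simpa using h.pow k
  | negSucc k =>
    rw [zpow_negSucc]
    exact (h.pow (k + 1)).inv

/-- `e^{iΣθᵢ}` is algebraic if all `e^{iθᵢ}` are. [folklore] -/
theorem isAlgebraic_exp_sum_mul_I {ι : Type*} (s : Finset ι) (θ : ι → ℝ)
    (h : ∀ i ∈ s, IsAlgebraic ℚ (cexp ((θ i : ℂ) * I))) :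
    IsAlgebraic ℚ (cexp (((∑ i ∈ s, θ i : ℝ) : ℂ) * I)) := by
  classical
  induction s using Finset.induction_on with
  | empty => simp only [Finset.sum_empty, Complex.ofReal_zero, zero_mul, Complex.exp_zero]; exact isAlgebraic_one
  | insert a s ha ih =>
    rw [Finset.sum_insert ha]
    exact isAlgebraic_exp_add_mul_I (h a (Finset.mem_insert_self a s))
      (ih fun i hi => h i (Finset.mem_insert_of_mem hi))

/-- `e^{i·arctan t}` is algebraic for real algebraic `t`. [folklore] -/
theorem isAlgebraic_exp_arctan_mul_I {t : ℝ} (ht : IsAlgebraic ℚ t) :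
    IsAlgebraic ℚ (cexp ((Real.arctan t : ℂ) * I)) := by
  have h := isAlgebraic_exp_div_nat (isAlgebraic_exp_two_arctan_mul_I ht) (M := 2) two_pos
  rwa [show (2 * Real.arctan t / (2:ℕ) : ℝ) = Real.arctan t by push_cast; ring] at h

/-! ## The signed arctangent element `E(θ, d)` of the quotient -/

/-- **The signed arctangent element.** For a family `RG` there is `E : ℝ → ℝ → FormalRep ⧸ relations`
with `E(θ, d) = [T(tan θ, d)]` for `θ ≥ 0` and `E(θ, d) = −[T(tan(−θ), d)]` for `θ < 0`.
[cite: KontsevichZagier2001, §1.2] -/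
theorem exists_signedAng (RG : ℝ → ℝ → IntegralRep 1) :
    ∃ E : ℝ → ℝ → FormalRep ⧸ relations,
      (∀ θ d, 0 ≤ θ → E θ d = QuotientAddGroup.mk' relations (of (RG (Real.tan θ) d))) ∧
      ∀ θ d, θ < 0 → E θ d = -QuotientAddGroup.mk' relations (of (RG (Real.tan (-θ)) d)) := by
  classical
  exact ⟨fun θ d => if 0 ≤ θ then QuotientAddGroup.mk' relations (of (RG (Real.tan θ) d))
      else -QuotientAddGroup.mk' relations (of (RG (Real.tan (-θ)) d)),
    fun θ d h => if_pos h, fun θ d h => if_neg (not_le.mpr h)⟩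

variable {RG : ℝ → ℝ → IntegralRep 1} {E : ℝ → ℝ → FormalRep ⧸ relations}

/-- A carrier with non-positive tangent parameter has empty domain, hence is a relation.
[cite: KontsevichZagier2001, §1.2 rule (1)] -/
theorem ang_nonpos_mem_relations
    (hRG : ∀ t d, IsAlgebraic ℚ t → IsAlgebraic ℚ d →
      (RG t d).domain = {x | x 0 ∈ Set.Ioo 0 t} ∧ (RG t d).integrand = fun x => d / (1 + x 0 ^ 2))
    {t d : ℝ} (ht : IsAlgebraic ℚ t) (hd : IsAlgebraic ℚ d) (ht0 : t ≤ 0) : of (RG t d) ∈ relations :=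
  slab_empty_mem_relations _ (hRG t d ht hd).1 ht0

/-- `E(0, d) = 0`. [cite: KontsevichZagier2001, §1.2 rule (1)] -/
theorem signedAng_zero
    (hRG : ∀ t d, IsAlgebraic ℚ t → IsAlgebraic ℚ d →
      (RG t d).domain = {x | x 0 ∈ Set.Ioo 0 t} ∧ (RG t d).integrand = fun x => d / (1 + x 0 ^ 2))
    (hEp : ∀ θ d, 0 ≤ θ → E θ d = QuotientAddGroup.mk' relations (of (RG (Real.tan θ) d)))
    {d : ℝ} (hd : IsAlgebraic ℚ d) : E 0 d = 0 := by
  rw [hEp 0 d le_rfl, Real.tan_zero]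
  exact (QuotientAddGroup.eq_zero_iff _).mpr (ang_nonpos_mem_relations hRG isAlgebraic_zero hd le_rfl)

/-- `E(−θ, d) = −E(θ, d)`. [cite: KontsevichZagier2001, §1.2] -/
theorem signedAng_neg
    (hRG : ∀ t d, IsAlgebraic ℚ t → IsAlgebraic ℚ d →
      (RG t d).domain = {x | x 0 ∈ Set.Ioo 0 t} ∧ (RG t d).integrand = fun x => d / (1 + x 0 ^ 2))
    (hEp : ∀ θ d, 0 ≤ θ → E θ d = QuotientAddGroup.mk' relations (of (RG (Real.tan θ) d)))
    (hEn : ∀ θ d, θ < 0 → E θ d = -QuotientAddGroup.mk' relations (of (RG (Real.tan (-θ)) d)))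
    {θ d : ℝ} (hd : IsAlgebraic ℚ d) : E (-θ) d = -E θ d := by
  rcases lt_trichotomy θ 0 with h | rfl | h
  · rw [hEp (-θ) d (by linarith), hEn θ d h, neg_neg]
  · rw [neg_zero, signedAng_zero hRG hEp hd, neg_zero]
  · rw [hEn (-θ) d (by linarith), hEp θ d h.le, neg_neg]

/-- **The addition law in angles, both non-negative**: for `0 ≤ θ₁, θ₂` with `θ₁ + θ₂ < Real.pi / 2` and
algebraic tangents, `[T(tan(θ₁+θ₂), d)] = [T(tan θ₁, d)] + [T(tan θ₂, d)]`.
[cite: KontsevichZagier2001, §1.2 rules (1), (2)] -/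
theorem signedAng_add_core
    (hRG : ∀ t d, IsAlgebraic ℚ t → IsAlgebraic ℚ d →
      (RG t d).domain = {x | x 0 ∈ Set.Ioo 0 t} ∧ (RG t d).integrand = fun x => d / (1 + x 0 ^ 2))
    {θ₁ θ₂ d : ℝ} (h₁ : 0 ≤ θ₁) (h₂ : 0 ≤ θ₂) (h₁₂ : θ₁ + θ₂ < Real.pi / 2)
    (ht₁ : IsAlgebraic ℚ (Real.tan θ₁)) (ht₂ : IsAlgebraic ℚ (Real.tan θ₂)) (hd : IsAlgebraic ℚ d) :
    QuotientAddGroup.mk' relations (of (RG (Real.tan (θ₁ + θ₂)) d)) =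
      QuotientAddGroup.mk' relations (of (RG (Real.tan θ₁) d)) +
        QuotientAddGroup.mk' relations (of (RG (Real.tan θ₂) d)) := by
  have hπ := Real.pi_pos
  have hθ₁ : θ₁ < Real.pi / 2 := by linarith
  have hθ₂ : θ₂ < Real.pi / 2 := by linarith
  have hs0 : 0 ≤ Real.tan θ₁ := Real.tan_nonneg_of_nonneg_of_le_pi_div_two h₁ hθ₁.le
  have ht0 : 0 ≤ Real.tan θ₂ := Real.tan_nonneg_of_nonneg_of_le_pi_div_two h₂ hθ₂.le
  have hst : Real.tan θ₁ * Real.tan θ₂ < 1 := by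
    rcases h₁.eq_or_lt with h₁' | h₁'
    · rw [← h₁', Real.tan_zero, zero_mul]; exact one_pos
    · have hspos := Real.tan_pos_of_pos_of_lt_pi_div_two h₁' hθ₁
      have hlt : Real.tan θ₂ < (Real.tan θ₁)⁻¹ := by
        rw [← Real.tan_pi_div_two_sub]
        exact Real.tan_lt_tan_of_lt_of_lt_pi_div_two (by linarith) (by linarith) (by linarith)
      calc Real.tan θ₁ * Real.tan θ₂ < Real.tan θ₁ * (Real.tan θ₁)⁻¹ :=
            mul_lt_mul_of_pos_left hlt hspos
        _ = 1 := mul_inv_cancel₀ hspos.ne'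
  have hsum : θ₁ + θ₂ = Real.arctan ((Real.tan θ₁ + Real.tan θ₂) / (1 - Real.tan θ₁ * Real.tan θ₂)) := by
    rw [← Real.arctan_add hst, Real.arctan_tan (by linarith) hθ₁, Real.arctan_tan (by linarith) hθ₂]
  have h := AngAddK2.ang_add_mem_relations hRG ht₁ ht₂ hd hs0 ht0 hst
  rw [hsum, Real.tan_arctan, add_comm (Real.tan θ₁)]
  rw [← QuotientAddGroup.eq_zero_iff] at h
  change QuotientAddGroup.mk' relations _ = 0 at h
  rwa [map_sub, map_sub, sub_sub, sub_eq_zero] at h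

/-- The addition law for `E`, first angle non-negative. [cite: KontsevichZagier2001, §1.2 rules (1), (2)] -/
theorem signedAng_add_left
    (hRG : ∀ t d, IsAlgebraic ℚ t → IsAlgebraic ℚ d →
      (RG t d).domain = {x | x 0 ∈ Set.Ioo 0 t} ∧ (RG t d).integrand = fun x => d / (1 + x 0 ^ 2))
    (hEp : ∀ θ d, 0 ≤ θ → E θ d = QuotientAddGroup.mk' relations (of (RG (Real.tan θ) d)))
    (hEn : ∀ θ d, θ < 0 → E θ d = -QuotientAddGroup.mk' relations (of (RG (Real.tan (-θ)) d)))
    {θ₁ θ₂ d : ℝ} (hs₁ : 0 ≤ θ₁) (h₁ : θ₁ < Real.pi / 2) (h₂ : |θ₂| < Real.pi / 2)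
    (h₁₂ : |θ₁ + θ₂| < Real.pi / 2)
    (he₁ : IsAlgebraic ℚ (cexp ((θ₁:ℂ) * I))) (he₂ : IsAlgebraic ℚ (cexp ((θ₂:ℂ) * I)))
    (hd : IsAlgebraic ℚ d) : E (θ₁ + θ₂) d = E θ₁ d + E θ₂ d := by
  rw [abs_lt] at h₂ h₁₂
  have h12 := isAlgebraic_exp_add_mul_I he₁ he₂
  rcases le_or_gt 0 θ₂ with hs₂ | hs₂
  · rw [hEp _ d (add_nonneg hs₁ hs₂), hEp _ d hs₁, hEp _ d hs₂]
    exact signedAng_add_core hRG hs₁ hs₂ h₁₂.2 (isAlgebraic_tan_of_exp he₁)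
      (isAlgebraic_tan_of_exp he₂) hd
  rcases le_or_gt 0 (θ₁ + θ₂) with hs | hs
  · have hc := signedAng_add_core hRG (θ₁ := θ₁ + θ₂) (θ₂ := -θ₂) hs (by linarith) (by linarith)
      (isAlgebraic_tan_of_exp h12) (isAlgebraic_tan_of_exp (isAlgebraic_exp_neg_mul_I he₂)) hd
    rw [show θ₁ + θ₂ + -θ₂ = θ₁ by ring] at hc
    rw [hEp _ d hs, hEp _ d hs₁, hEn _ d hs₂, hc]
    abel
  · have hc := signedAng_add_core hRG (θ₁ := -(θ₁ + θ₂)) (θ₂ := θ₁) (by linarith) hs₁ (by linarith)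
      (isAlgebraic_tan_of_exp (isAlgebraic_exp_neg_mul_I h12)) (isAlgebraic_tan_of_exp he₁) hd
    rw [show -(θ₁ + θ₂) + θ₁ = -θ₂ by ring] at hc
    rw [hEn _ d hs, hEp _ d hs₁, hEn _ d hs₂, hc]
    abel

/-- **The addition law for the signed arctangent element**: `E(θ₁ + θ₂) = E(θ₁) + E(θ₂)` whenever
`|θ₁|, |θ₂|, |θ₁ + θ₂| < Real.pi / 2` and `e^{iθ₁}`, `e^{iθ₂}` are algebraic.
[cite: KontsevichZagier2001, §1.2 rules (1), (2)] -/
theorem signedAng_add {RG : ℝ → ℝ → IntegralRep 1} {E : ℝ → ℝ → FormalRep ⧸ relations}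
    (hRG : ∀ t d, IsAlgebraic ℚ t → IsAlgebraic ℚ d →
      (RG t d).domain = {x | x 0 ∈ Set.Ioo 0 t} ∧ (RG t d).integrand = fun x => d / (1 + x 0 ^ 2))
    (hEp : ∀ θ d, 0 ≤ θ → E θ d = QuotientAddGroup.mk' relations (of (RG (Real.tan θ) d)))
    (hEn : ∀ θ d, θ < 0 → E θ d = -QuotientAddGroup.mk' relations (of (RG (Real.tan (-θ)) d)))
    {θ₁ θ₂ d : ℝ} (h₁ : |θ₁| < Real.pi / 2) (h₂ : |θ₂| < Real.pi / 2) (h₁₂ : |θ₁ + θ₂| < Real.pi / 2)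
    (he₁ : IsAlgebraic ℚ (cexp ((θ₁:ℂ) * I))) (he₂ : IsAlgebraic ℚ (cexp ((θ₂:ℂ) * I)))
    (hd : IsAlgebraic ℚ d) : E (θ₁ + θ₂) d = E θ₁ d + E θ₂ d := by
  rcases le_or_gt 0 θ₁ with hs₁ | hs₁
  · exact signedAng_add_left hRG hEp hEn hs₁ (abs_lt.mp h₁).2 h₂ h₁₂ he₁ he₂ hd
  rcases le_or_gt 0 θ₂ with hs₂ | hs₂
  · rw [add_comm, signedAng_add_left hRG hEp hEn hs₂ (abs_lt.mp h₂).2 h₁ (by rwa [add_comm]) he₂ he₁ hd,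
      add_comm]
  · rw [abs_lt] at h₁ h₂ h₁₂
    have hc := signedAng_add_core hRG (θ₁ := -θ₁) (θ₂ := -θ₂) (by linarith) (by linarith) (by linarith)
      (isAlgebraic_tan_of_exp (isAlgebraic_exp_neg_mul_I he₁))
      (isAlgebraic_tan_of_exp (isAlgebraic_exp_neg_mul_I he₂)) hd
    rw [hEn _ d (by linarith : θ₁ + θ₂ < 0), hEn _ d hs₁, hEn _ d hs₂, neg_add, hc, neg_add]

/-- **Natural multiples**: `E(nθ) = n • E(θ)` if `n|θ| < Real.pi / 2`. [cite: KontsevichZagier2001, §1.2] -/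
theorem signedAng_nsmul
    (hRG : ∀ t d, IsAlgebraic ℚ t → IsAlgebraic ℚ d →
      (RG t d).domain = {x | x 0 ∈ Set.Ioo 0 t} ∧ (RG t d).integrand = fun x => d / (1 + x 0 ^ 2))
    (hEp : ∀ θ d, 0 ≤ θ → E θ d = QuotientAddGroup.mk' relations (of (RG (Real.tan θ) d)))
    (hEn : ∀ θ d, θ < 0 → E θ d = -QuotientAddGroup.mk' relations (of (RG (Real.tan (-θ)) d)))
    {θ d : ℝ} (he : IsAlgebraic ℚ (cexp ((θ:ℂ) * I))) (hd : IsAlgebraic ℚ d) :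
    ∀ n : ℕ, (n : ℝ) * |θ| < Real.pi / 2 → E (n * θ) d = n • E θ d := by
  intro n
  induction n with
  | zero =>
    intro _
    rw [Nat.cast_zero, zero_mul, zero_smul]
    exact signedAng_zero hRG hEp hd
  | succ n ih =>
    intro hn
    push_cast at hn ⊢
    have h0 := abs_nonneg θ
    have hθ : |θ| < Real.pi / 2 := by nlinarith
    have hn' : (n:ℝ) * |θ| < Real.pi / 2 := by nlinarith
    have hnθ : |(n:ℝ) * θ| < Real.pi / 2 := by rw [abs_mul, Nat.abs_cast]; exact hn'
    have hsum : |(n:ℝ) * θ + θ| < Real.pi / 2 := by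
      rw [show (n:ℝ) * θ + θ = (n + 1) * θ by ring, abs_mul, abs_of_nonneg (by positivity)]
      exact hn
    rw [add_mul, one_mul, signedAng_add hRG hEp hEn hnθ hθ hsum (isAlgebraic_exp_nat_mul_mul_I he n)
      he hd, ih hn', add_smul, one_smul]

/-- **Integer multiples**: `E(nθ) = n • E(θ)` if `|n||θ| < Real.pi / 2`. [cite: KontsevichZagier2001, §1.2] -/
theorem signedAng_zsmul
    (hRG : ∀ t d, IsAlgebraic ℚ t → IsAlgebraic ℚ d →
      (RG t d).domain = {x | x 0 ∈ Set.Ioo 0 t} ∧ (RG t d).integrand = fun x => d / (1 + x 0 ^ 2))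
    (hEp : ∀ θ d, 0 ≤ θ → E θ d = QuotientAddGroup.mk' relations (of (RG (Real.tan θ) d)))
    (hEn : ∀ θ d, θ < 0 → E θ d = -QuotientAddGroup.mk' relations (of (RG (Real.tan (-θ)) d)))
    {θ d : ℝ} (he : IsAlgebraic ℚ (cexp ((θ:ℂ) * I))) (hd : IsAlgebraic ℚ d) (n : ℤ)
    (hn : |(n : ℝ)| * |θ| < Real.pi / 2) : E (n * θ) d = n • E θ d := by
  obtain ⟨m, rfl | rfl⟩ := n.eq_nat_or_neg
  · rw [Int.cast_natCast, Nat.abs_cast] at hn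
    rw [Int.cast_natCast, natCast_zsmul, signedAng_nsmul hRG hEp hEn he hd m hn]
  · rw [Int.cast_neg, Int.cast_natCast, abs_neg, Nat.abs_cast] at hn
    rw [Int.cast_neg, Int.cast_natCast, neg_mul, signedAng_neg hRG hEp hEn hd, neg_smul, natCast_zsmul,
      signedAng_nsmul hRG hEp hEn he hd m hn]

/-- **Integer combinations**: `E(Σ nᵢ gᵢ) = Σ nᵢ • E(gᵢ)` if `Σ |nᵢ||gᵢ| < Real.pi / 2`, `|gᵢ| < Real.pi / 2` and all
`e^{igᵢ}` are algebraic (all partial sums stay inside `(−Real.pi / 2, Real.pi / 2)`).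
[cite: KontsevichZagier2001, §1.2 rules (1), (2)] -/
theorem signedAng_sum {RG : ℝ → ℝ → IntegralRep 1} {E : ℝ → ℝ → FormalRep ⧸ relations}
    (hRG : ∀ t d, IsAlgebraic ℚ t → IsAlgebraic ℚ d →
      (RG t d).domain = {x | x 0 ∈ Set.Ioo 0 t} ∧ (RG t d).integrand = fun x => d / (1 + x 0 ^ 2))
    (hEp : ∀ θ d, 0 ≤ θ → E θ d = QuotientAddGroup.mk' relations (of (RG (Real.tan θ) d)))
    (hEn : ∀ θ d, θ < 0 → E θ d = -QuotientAddGroup.mk' relations (of (RG (Real.tan (-θ)) d)))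
    {ι : Type*} (S : Finset ι) (g : ι → ℝ) (n : ι → ℤ) {d : ℝ} (hd : IsAlgebraic ℚ d)
    (he : ∀ i ∈ S, IsAlgebraic ℚ (cexp ((g i : ℂ) * I))) (hg : ∀ i ∈ S, |g i| < Real.pi / 2)
    (hb : ∑ i ∈ S, |(n i : ℝ)| * |g i| < Real.pi / 2) :
    E (∑ i ∈ S, (n i : ℝ) * g i) d = ∑ i ∈ S, n i • E (g i) d := by
  classical
  induction S using Finset.induction_on with
  | empty =>
    rw [Finset.sum_empty, Finset.sum_empty]
    exact signedAng_zero hRG hEp hd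
  | insert a S ha ih =>
    rw [Finset.sum_insert ha] at hb
    rw [Finset.sum_insert ha, Finset.sum_insert ha]
    have hnn : ∀ i, 0 ≤ |(n i : ℝ)| * |g i| := fun i => by positivity
    have hSnn : 0 ≤ ∑ i ∈ S, |(n i : ℝ)| * |g i| := Finset.sum_nonneg fun i _ => hnn i
    have hbS : ∑ i ∈ S, |(n i : ℝ)| * |g i| < Real.pi / 2 := by linarith [hnn a]
    have hba : |(n a : ℝ) * g a| < Real.pi / 2 := by rw [abs_mul]; linarith
    have hS_abs' : |∑ i ∈ S, (n i : ℝ) * g i| ≤ ∑ i ∈ S, |(n i : ℝ)| * |g i| :=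
      (Finset.abs_sum_le_sum_abs _ _).trans (le_of_eq (Finset.sum_congr rfl fun i _ => abs_mul _ _))
    have hS_abs : |∑ i ∈ S, (n i : ℝ) * g i| < Real.pi / 2 := hS_abs'.trans_lt hbS
    have hsum_abs : |(n a : ℝ) * g a + ∑ i ∈ S, (n i : ℝ) * g i| < Real.pi / 2 := by
      refine (abs_add_le _ _).trans_lt ?_
      rw [abs_mul]
      linarith
    rw [signedAng_add hRG hEp hEn hba hS_abs hsum_abs
      (isAlgebraic_exp_int_mul_mul_I (he a (Finset.mem_insert_self a S)) (n a))
      (isAlgebraic_exp_sum_mul_I S (fun i => (n i : ℝ) * g i) fun i hi =>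
        isAlgebraic_exp_int_mul_mul_I (he i (Finset.mem_insert_of_mem hi)) (n i)) hd,
      ih (fun i hi => he i (Finset.mem_insert_of_mem hi)) (fun i hi => hg i (Finset.mem_insert_of_mem hi))
        hbS,
      signedAng_zsmul hRG hEp hEn (he a (Finset.mem_insert_self a S)) hd (n a) ?_]
    have hga := hg a (Finset.mem_insert_self a S)
    -- `|n a| |g a| < Real.pi / 2`
    linarith [hnn a]

end Dlog

end Summit.KontsevichZagierPeriods.HurwitzMicroSectors.NormalFormPrinciple.PiBox
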